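import Summits.HodgeConjecture.HodgeConjecture.Theorems.VHCAbelianSchemesRoadIsogenyPushforwardExtAdjunctionOfFlatPullback
import Literature.AlgebraicGeometry.Modules.PullbackStalk
import HarnessLib

/-!
# Road №4 (`VHCAbelianSchemesRoad`) — (Adj) `PullbackPushforwardExtAdjunction` AND PIECE (R) `IsogenyPushforwardExtRankTransfer`
# ARE THEOREMS; THEOREM T′ (stub (c1) of crux stmt-HodgeConjecture-26512) DISPLAYS (SC) ALONE

research route conditional on HC_CM; not a corollary; Q11.4-sentence-2 already refuted in dim ≥ 3.

Seat core-w7 (route K; director-hodge g16 R16.11 (2), R16.13 (2), R16.18 (4)). `--supports stmt-HodgeConjecture-26512 --as helper`;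
closes NO stub or item by itself; nothing here says (SC), T′, (c1), 26511 ∕ 26512 ∕ 23176, `HC_AV`, `HC_CM` or HC holds; HC_CM HELD,
by name only; typed ≠ proved.

ROUTE K assembled: the displayed node of `…ExtAdjunctionOfFlatPullback.lean` («flat pull-back preserves monomorphisms of `𝒪`-modules»,
Stacks Tag 02N2) is now the tree's theorem `Literature.AlgebraicGeometry.Modules.preservesMonomorphisms_pullback_of_flat` (seat core-qc,
`Modules/PullbackStalk`, on core-w2's `Modules/SkyscraperModule`: stalks of `f^*N` are `𝒪_{X,x} ⊗ N_{f x}`, flat base change,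
monomorphisms are stalk-local), and an isogeny is flat (`AbelianVariety.IsIsogeny.flat`, `NumberTheory/DiophantineGeometry/AVIsogenyFlat`).

* **`pullbackPushforwardExtAdjunction_holds : PullbackPushforwardExtAdjunction`** — (Adj) (core-R p644270) PROVED: for every isogeny
  `g` of a complex abelian variety, every cochain complex `M•`, every bounded vector-bundle complex `E•`, every `k`,
  `Hom_{D(Mod 𝒪_A)}(Q(g^*M•), Q(E•)⟦k⟧) ≃ₗ[ℂ] Hom_{D(Mod 𝒪_A)}(Q M•, Q(g_*E•)⟦k⟧)` (K-injective model of `Lg^* ⊣ Rg_*`: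
  `Literature/Algebra/Homology/KInjectiveAdjunction`, Leray + Tag 01XC `Modules/PushforwardInjectiveResolution` ∕
  `Modules/PushforwardAcyclicResolution`, enough injectives `Modules/ModulesGrothendieckAbelian`, flat pull-back `Modules/PullbackStalk`).
* **`isogenyPushforwardExtRankTransfer_holds : IsogenyPushforwardExtRankTransfer`** — PIECE (R) of THEOREM T′ PROVED
  (core-R's `isogenyPushforwardExtRankTransfer_of_extAdjunction`, p644270, with (D♮) core-D).
* **`isogenyPushforwardAdmissibilityTransferPrime_of_isISemiregularCTransfer :
  IsogenyPushforwardISemiregularCTransfer → IsogenyPushforwardAdmissibilityTransferPrime`** — THEOREM T′ from (SC) ALONE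
  (core-B's `…_of_cores'''`; pieces (D), (B), (R) theorems).

References: [cite: Lipman2009, Prop. 3.2.3] [cite: Spaltenstein1988, Prop. 1.5 and §6] [cite: StacksProject, Tag 01XC, Tag 02N2 and Tag 09T5]
[cite: Hartshorne1977, II §5 p. 110 (f^* ⊣ f_*), III Prop. 8.1, III Prop. 1.2A] [cite: Mukai1978, §3 Prop. 3.12 (p. 249)]
[cite: MumfordAV1970, §7 Thm. 4 (p. 72)] [cite: GortzWedhorn2020, (7.18.1) with (7.8.6)].
-/

noncomputable section

open CategoryTheory CategoryTheory.Limits AlgebraicGeometry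

namespace Summit.HodgeConjecture.HodgeConjecture.Ring2.SemiregularRepresentatives

set_option linter.dupNamespace false -- the cell's namespace repeats the summit name, as in every `Ring2*` file

open Literature.AlgebraicGeometry Literature.AlgebraicGeometry.Motives Literature.AlgebraicGeometry.Motives.AbelianVariety
open Literature.AlgebraicGeometry.Modules

/-- **(Adj) `PullbackPushforwardExtAdjunction` IS A THEOREM** — the `Ext`-adjunction along an isogeny,
`Hom_{D(Mod 𝒪_A)}(Q(g^*M•), Q(E•)⟦k⟧) ≃ₗ[ℂ] Hom_{D(Mod 𝒪_A)}(Q M•, Q(g_*E•)⟦k⟧)` for every isogeny `g` of a complex abelian variety,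
every cochain complex `M•`, every bounded vector-bundle complex `E•` and every `k` (route K: K-injective model of `Lg^* ⊣ Rg_*`;
`Rg_*E• = g_*E•` by Leray + Tag 01XC; `g_*I•` K-injective because the flat pull-back `g^*` preserves monomorphisms,
`preservesMonomorphisms_pullback_of_flat` + `AbelianVariety.IsIsogeny.flat`). Unconditional; closes no stub by itself; HC_CM untouched.
[cite: Lipman2009, Prop. 3.2.3] [cite: StacksProject, Tag 01XC and Tag 02N2] [cite: Hartshorne1977, II §5 p. 110 (f^* ⊣ f_*) and III Prop. 8.1] -/
theorem pullbackPushforwardExtAdjunction_holds : PullbackPushforwardExtAdjunction :=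
  pullbackPushforwardExtAdjunction_of_pullbackPreservesMono fun _ g hg =>
    haveI := AbelianVariety.IsIsogeny.flat hg
    preservesMonomorphisms_pullback_of_flat (Hom.toSchemeHom g)

/-- **PIECE (R) `IsogenyPushforwardExtRankTransfer` IS A THEOREM**: `rank Ext^k(g_*E•, g_*E•) = rank Ext^k(E•, E•)` for every isogeny
`g` of a complex abelian variety, every bounded vector-bundle complex `E•` with (C^∨) and every `k` (core-R's reduction to (Adj) ∧ (D♮),
both theorems). Unconditional; closes no stub by itself; HC_CM untouched. [cite: Mukai1978, §3 Prop. 3.12 (p. 249)]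
[cite: MumfordAV1970, §7 Thm. 4 (p. 72)] [cite: Lipman2009, Prop. 3.2.3] -/
theorem isogenyPushforwardExtRankTransfer_holds : IsogenyPushforwardExtRankTransfer :=
  isogenyPushforwardExtRankTransfer_of_extAdjunction pullbackPushforwardExtAdjunction_holds

/-- **THEOREM T′ (stub (c1) of crux stmt-HodgeConjecture-26512) FROM THE σ-CORE (SC) ALONE**:
`IsogenyPushforwardISemiregularCTransfer → IsogenyPushforwardAdmissibilityTransferPrime` — pieces (D), (D♮), (B), (R) of the
reassembly of record are theorems. CONDITIONAL on (SC) only; closes no stub; HC_CM untouched.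
[cite: BuchweitzFlenner2003, §3, Def. 4.1 and §5 Thm. 5.1] [cite: MumfordAV1970, §7 Thm. 4 (p. 72)] [cite: GortzWedhorn2020, Prop. 12.13 (p. 410)] -/
theorem isogenyPushforwardAdmissibilityTransferPrime_of_isISemiregularCTransfer
    (hSC : IsogenyPushforwardISemiregularCTransfer) : IsogenyPushforwardAdmissibilityTransferPrime :=
  isogenyPushforwardAdmissibilityTransferPrime_of_extAdjunction_of_isISemiregularCTransfer
    pullbackPushforwardExtAdjunction_holds hSC

end Summit.HodgeConjecture.HodgeConjecture.Ring2.SemiregularRepresentatives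

end
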